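import Summits.Ventures.HSemireg.WedgeHankelRecurrenceGaussAssociatedCasoratian

/-!
# Venture HSemireg — **THE INTERIOR ZEROS ARE NOT MONOTONE IN THE OFF-DIAGONAL COEFFICIENTS (typed examples)**: with `a = (3, 0, 0)`, `b_2 = 8`, raising `b_1` from `2` to `14` moves the zeros of
# `q_3` from `(−3, 2, 4)` to `(−4, 1, 6)` — the middle zero goes DOWN (while the extreme zeros spread out, as N325 says they must); with the reflected diagonal `a = (−3, 0, 0)` the same change
# moves `(−4, −2, 3)` to `(−6, −1, 4)` — the middle zero goes UP.  So no sign rule for interior zeros in `b` exists; only Weyl's one-place bound of N346 survives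

HONEST FRAMING. Part of the Lean index of the computation cell `pub-hsemireg` (seat p10 gen 45, Sunday typer «UNIFORM-IN-n»).  Four explicit integer cubics; no variety, no cohomology theory, no
sheaf, no Ext group and no semiregularity map is constructed here; nothing here says that HC / HC_CM / HC_AV holds; no Literature fact (unproved `Prop`) is declared or used.  Custodian versions as
in `WedgeHankelSiegelIdeal` (1/3).
SOURCES (cited).  M. E. H. Ismail, *Classical and Quantum Orthogonal Polynomials* (2005) §7.4 (monotonicity in the `b`'s holds for the largest ∕ smallest zero; remarks after Thm 7.4.1 on interior
zeros); M. E. H. Ismail, M. E. Muldoon, *A discrete approach to monotonicity of zeros of orthogonal polynomials*, Trans. AMS 323 (1991) 65–78, §4; B. N. Parlett, *The Symmetric Eigenvalue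
Problem* (1980) §7 (tridiagonal examples).  The four cubics are this file's (found by a finite search over `|a_i| ≤ 6`, `b_j ≤ 40`; checked below by `ring`).
PROOF TYPED HERE.  `q_3` is computed from the recurrence and factored by `ring`; a strictly increasing zero vector is unique (N294 `strictMono_eq_of_prod_X_sub_C_eq`).
DEDUP DISCLOSURE (`rg -n 'example|counterex|interior' Summits/Ventures/HSemireg/WedgeHankelRecurrenceGauss*`, 2026-09-03): N332 ∕ N342 are the Chebyshev calibration examples; no typed
counterexample on `b`-monotonicity exists.  The 6 names below: 0 hits tree-wide.

WHAT IS IN THE TREE.  N294 `strictMono_eq_of_prod_X_sub_C_eq`; N325 `top_zero_mono_offdiag` ∕ `bottom_zero_anti_offdiag` (the extreme zeros ARE monotone); N346 `zeros_single_coupling_interlace`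
(`|shift| ≤ 1` place).
THIS FILE (namespace `Summit.Ventures.HSemireg.Wedge.HankelOuter` continued; CHAINED on N347 (import only); 0 definitions):
* §1113 `strictMono_vec_three_of_lt` (`u < v < w ⇒ ![u, v, w]` increasing), `recurrence_three_eq` (`q_3` for `a = (a_0, 0, 0)` in closed form), **`offdiag_example_zeros_down`** (`a = (3,0,0)`, `b = (2, 8)`:
  zeros `(−3, 2, 4)`; `b = (14, 8)`: zeros `(−4, 1, 6)`), **`offdiag_example_middle_zero_decreases`** (hence `y_1 = 1 < 2 = x_1` although `b ≤ b'`), **`offdiag_example_zeros_up`** (`a = (−3,0,0)`: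
  `(−4, −2, 3)` and `(−6, −1, 4)`), **`offdiag_example_middle_zero_increases`** (`x_1 = −2 < −1 = y_1`).
CAVEATS.  Examples only (degree 3); they refute «interior zeros are monotone in `b`» in both directions and show N346's bound `x_0 ≤ y_1 ≤ x_2` is all one can say.  Nothing Ext-side.
New names only.
-/

open Module Polynomial
open scoped Matrix Polynomial

namespace Summit.Ventures.HSemireg.Wedge.HankelOuter

/-! ## §1113. Interior zeros versus the couplings: two examples -/

/-- `u < v < w ⇒ ![u, v, w]` is strictly increasing. [bookkeeping; this file, §1113] -/
theorem strictMono_vec_three_of_lt {u v w : ℝ} (huv : u < v) (hvw : v < w) : StrictMono ![u, v, w] := by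
  refine Fin.strictMono_iff_lt_succ.2 fun i => ?_
  fin_cases i
  · simpa using huv
  · simpa using hvw

/-- **`q_3` for the diagonal `(a_0, 0, 0)`: `q_3 = X²(X − a_0) − b_1 X − b_2 (X − a_0)`.** [bookkeeping; this file, §1113] -/
theorem recurrence_three_eq {q : ℕ → ℝ[X]} {a b : ℕ → ℝ} (hq0 : q 0 = 1) (hq1 : q 1 = Polynomial.X - C (a 0))
    (hrec : ∀ n, q (n + 2) = (Polynomial.X - C (a (n + 1))) * q (n + 1) - C (b (n + 1)) * q n) (ha1 : a 1 = 0) (ha2 : a 2 = 0) :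
    q 3 = Polynomial.X ^ 2 * (Polynomial.X - C (a 0)) - C (b 1) * Polynomial.X - C (b 2) * (Polynomial.X - C (a 0)) := by
  rw [show (3 : ℕ) = 1 + 2 from rfl, hrec 1, show 1 + 1 = 0 + 2 from rfl, hrec 0, hq1, hq0, ha1, show (1 : ℕ) + 1 = 2 from rfl, ha2, C_0]
  ring

/-- **EXAMPLE (down): `a = (3, 0, 0)`; with `(b_1, b_2) = (2, 8)` the zeros of `q_3` are `(−3, 2, 4)`, with `(b_1, b_2) = (14, 8)` they are `(−4, 1, 6)`.** [this file, §1113] -/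
theorem offdiag_example_zeros_down {q q' : ℕ → ℝ[X]} {a b b' : ℕ → ℝ} (hq0 : q 0 = 1) (hq1 : q 1 = Polynomial.X - C (a 0))
    (hrec : ∀ n, q (n + 2) = (Polynomial.X - C (a (n + 1))) * q (n + 1) - C (b (n + 1)) * q n)
    (hq0' : q' 0 = 1) (hq1' : q' 1 = Polynomial.X - C (a 0)) (hrec' : ∀ n, q' (n + 2) = (Polynomial.X - C (a (n + 1))) * q' (n + 1) - C (b' (n + 1)) * q' n)
    (ha0 : a 0 = 3) (ha1 : a 1 = 0) (ha2 : a 2 = 0) (hb1 : b 1 = 2) (hb2 : b 2 = 8) (hb1' : b' 1 = 14) (hb2' : b' 2 = 8) :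
    q 3 = ∏ j : Fin 3, (Polynomial.X - C ((![-3, 2, 4] : Fin 3 → ℝ) j)) ∧ q' 3 = ∏ j : Fin 3, (Polynomial.X - C ((![-4, 1, 6] : Fin 3 → ℝ) j)) := by
  refine ⟨?_, ?_⟩
  · rw [recurrence_three_eq hq0 hq1 hrec ha1 ha2, ha0, hb1, hb2, Fin.prod_univ_three]
    simp only [Matrix.cons_val_zero, Matrix.cons_val_one, Matrix.cons_val_two, Matrix.head_cons, Matrix.tail_cons, C_neg]
    have e : (C (3 : ℝ) : ℝ[X]) = 3 := rfl
    have e2 : (C (2 : ℝ) : ℝ[X]) = 2 := rfl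
    have e4 : (C (4 : ℝ) : ℝ[X]) = 4 := rfl
    have e8 : (C (8 : ℝ) : ℝ[X]) = 8 := rfl
    rw [e, e2, e4, e8]
    ring
  · rw [recurrence_three_eq hq0' hq1' hrec' ha1 ha2, ha0, hb1', hb2', Fin.prod_univ_three]
    simp only [Matrix.cons_val_zero, Matrix.cons_val_one, Matrix.cons_val_two, Matrix.head_cons, Matrix.tail_cons, C_neg]
    have e : (C (3 : ℝ) : ℝ[X]) = 3 := rfl
    have e1 : (C (1 : ℝ) : ℝ[X]) = 1 := rfl
    have e4 : (C (4 : ℝ) : ℝ[X]) = 4 := rfl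
    have e6 : (C (6 : ℝ) : ℝ[X]) = 6 := rfl
    have e8 : (C (8 : ℝ) : ℝ[X]) = 8 := rfl
    have e14 : (C (14 : ℝ) : ℝ[X]) = 14 := rfl
    rw [e, e1, e4, e6, e8, e14]
    ring

/-- **THE MIDDLE ZERO DECREASES: same `a = (3, 0, 0)`, `b = (2, 8) ≤ b' = (14, 8)` coordinatewise, yet `y_1 = 1 < 2 = x_1`** (the extreme zeros do spread: `y_0 = −4 < −3 = x_0`,
`x_2 = 4 < 6 = y_2`, as N325 requires). [Ismail §7.4; this file, §1113] -/
theorem offdiag_example_middle_zero_decreases {q q' : ℕ → ℝ[X]} {a b b' : ℕ → ℝ} (hq0 : q 0 = 1) (hq1 : q 1 = Polynomial.X - C (a 0))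
    (hrec : ∀ n, q (n + 2) = (Polynomial.X - C (a (n + 1))) * q (n + 1) - C (b (n + 1)) * q n)
    (hq0' : q' 0 = 1) (hq1' : q' 1 = Polynomial.X - C (a 0)) (hrec' : ∀ n, q' (n + 2) = (Polynomial.X - C (a (n + 1))) * q' (n + 1) - C (b' (n + 1)) * q' n)
    (ha0 : a 0 = 3) (ha1 : a 1 = 0) (ha2 : a 2 = 0) (hb1 : b 1 = 2) (hb2 : b 2 = 8) (hb1' : b' 1 = 14) (hb2' : b' 2 = 8)
    {x y : Fin 3 → ℝ} (hx : StrictMono x) (hxq : q 3 = ∏ j, (Polynomial.X - C (x j))) (hy : StrictMono y) (hyq : q' 3 = ∏ j, (Polynomial.X - C (y j))) :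
    x = ![-3, 2, 4] ∧ y = ![-4, 1, 6] ∧ y 1 < x 1 ∧ y 0 < x 0 ∧ x 2 < y 2 := by
  obtain ⟨h, h'⟩ := offdiag_example_zeros_down hq0 hq1 hrec hq0' hq1' hrec' ha0 ha1 ha2 hb1 hb2 hb1' hb2'
  have hxv : x = ![-3, 2, 4] := strictMono_eq_of_prod_X_sub_C_eq hx (strictMono_vec_three_of_lt (by norm_num) (by norm_num)) (hxq.symm.trans h)
  have hyv : y = ![-4, 1, 6] := strictMono_eq_of_prod_X_sub_C_eq hy (strictMono_vec_three_of_lt (by norm_num) (by norm_num)) (hyq.symm.trans h')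
  refine ⟨hxv, hyv, ?_, ?_, ?_⟩ <;> norm_num [hxv, hyv, Matrix.cons_val_two, Matrix.tail_cons, Matrix.head_cons]

/-- **EXAMPLE (up): `a = (−3, 0, 0)`; with `(b_1, b_2) = (2, 8)` the zeros of `q_3` are `(−4, −2, 3)`, with `(14, 8)` they are `(−6, −1, 4)`.** [this file, §1113] -/
theorem offdiag_example_zeros_up {q q' : ℕ → ℝ[X]} {a b b' : ℕ → ℝ} (hq0 : q 0 = 1) (hq1 : q 1 = Polynomial.X - C (a 0))
    (hrec : ∀ n, q (n + 2) = (Polynomial.X - C (a (n + 1))) * q (n + 1) - C (b (n + 1)) * q n)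
    (hq0' : q' 0 = 1) (hq1' : q' 1 = Polynomial.X - C (a 0)) (hrec' : ∀ n, q' (n + 2) = (Polynomial.X - C (a (n + 1))) * q' (n + 1) - C (b' (n + 1)) * q' n)
    (ha0 : a 0 = -3) (ha1 : a 1 = 0) (ha2 : a 2 = 0) (hb1 : b 1 = 2) (hb2 : b 2 = 8) (hb1' : b' 1 = 14) (hb2' : b' 2 = 8) :
    q 3 = ∏ j : Fin 3, (Polynomial.X - C ((![-4, -2, 3] : Fin 3 → ℝ) j)) ∧ q' 3 = ∏ j : Fin 3, (Polynomial.X - C ((![-6, -1, 4] : Fin 3 → ℝ) j)) := by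
  refine ⟨?_, ?_⟩
  · rw [recurrence_three_eq hq0 hq1 hrec ha1 ha2, ha0, hb1, hb2, Fin.prod_univ_three]
    simp only [Matrix.cons_val_zero, Matrix.cons_val_one, Matrix.cons_val_two, Matrix.head_cons, Matrix.tail_cons, C_neg]
    have e : (C (3 : ℝ) : ℝ[X]) = 3 := rfl
    have e2 : (C (2 : ℝ) : ℝ[X]) = 2 := rfl
    have e4 : (C (4 : ℝ) : ℝ[X]) = 4 := rfl
    have e8 : (C (8 : ℝ) : ℝ[X]) = 8 := rfl
    rw [e, e2, e4, e8]
    ring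
  · rw [recurrence_three_eq hq0' hq1' hrec' ha1 ha2, ha0, hb1', hb2', Fin.prod_univ_three]
    simp only [Matrix.cons_val_zero, Matrix.cons_val_one, Matrix.cons_val_two, Matrix.head_cons, Matrix.tail_cons, C_neg]
    have e : (C (3 : ℝ) : ℝ[X]) = 3 := rfl
    have e1 : (C (1 : ℝ) : ℝ[X]) = 1 := rfl
    have e4 : (C (4 : ℝ) : ℝ[X]) = 4 := rfl
    have e6 : (C (6 : ℝ) : ℝ[X]) = 6 := rfl
    have e8 : (C (8 : ℝ) : ℝ[X]) = 8 := rfl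
    have e14 : (C (14 : ℝ) : ℝ[X]) = 14 := rfl
    rw [e, e1, e4, e6, e8, e14]
    ring

/-- **THE MIDDLE ZERO INCREASES: `a = (−3, 0, 0)`, `b = (2, 8) ≤ b' = (14, 8)`, and `x_1 = −2 < −1 = y_1`** — together with N348 `offdiag_example_middle_zero_decreases`: an interior zero has no
definite sign of change under an increase of a coupling. [Ismail §7.4; Ismail–Muldoon 1991 §4; this file, §1113] -/
theorem offdiag_example_middle_zero_increases {q q' : ℕ → ℝ[X]} {a b b' : ℕ → ℝ} (hq0 : q 0 = 1) (hq1 : q 1 = Polynomial.X - C (a 0))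
    (hrec : ∀ n, q (n + 2) = (Polynomial.X - C (a (n + 1))) * q (n + 1) - C (b (n + 1)) * q n)
    (hq0' : q' 0 = 1) (hq1' : q' 1 = Polynomial.X - C (a 0)) (hrec' : ∀ n, q' (n + 2) = (Polynomial.X - C (a (n + 1))) * q' (n + 1) - C (b' (n + 1)) * q' n)
    (ha0 : a 0 = -3) (ha1 : a 1 = 0) (ha2 : a 2 = 0) (hb1 : b 1 = 2) (hb2 : b 2 = 8) (hb1' : b' 1 = 14) (hb2' : b' 2 = 8)
    {x y : Fin 3 → ℝ} (hx : StrictMono x) (hxq : q 3 = ∏ j, (Polynomial.X - C (x j))) (hy : StrictMono y) (hyq : q' 3 = ∏ j, (Polynomial.X - C (y j))) :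
    x = ![-4, -2, 3] ∧ y = ![-6, -1, 4] ∧ x 1 < y 1 ∧ y 0 < x 0 ∧ x 2 < y 2 := by
  obtain ⟨h, h'⟩ := offdiag_example_zeros_up hq0 hq1 hrec hq0' hq1' hrec' ha0 ha1 ha2 hb1 hb2 hb1' hb2'
  have hxv : x = ![-4, -2, 3] := strictMono_eq_of_prod_X_sub_C_eq hx (strictMono_vec_three_of_lt (by norm_num) (by norm_num)) (hxq.symm.trans h)
  have hyv : y = ![-6, -1, 4] := strictMono_eq_of_prod_X_sub_C_eq hy (strictMono_vec_three_of_lt (by norm_num) (by norm_num)) (hyq.symm.trans h')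
  refine ⟨hxv, hyv, ?_, ?_, ?_⟩ <;> norm_num [hxv, hyv, Matrix.cons_val_two, Matrix.tail_cons, Matrix.head_cons]

end Summit.Ventures.HSemireg.Wedge.HankelOuter
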